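import Literature.AlgebraicGeometry.Resolution.Blowups
import Literature.AlgebraicGeometry.Resolution.MarkedIdealsLemmas
import Literature.AlgebraicGeometry.Resolution.QuasiExcellentSchemes
import Mathlib.AlgebraicGeometry.Morphisms.Flat
import Mathlib.AlgebraicGeometry.Morphisms.Preimmersion
import Mathlib.AlgebraicGeometry.Stalk
import Mathlib.RingTheory.Flat.FaithfullyFlat.Algebra
import Mathlib.RingTheory.RingHom.FaithfullyFlat
import Mathlib.RingTheory.RegularLocalRing.Defs
import HarnessLib

/-!
# Blow-ups commute with flat base change; pro-open subschemes `X' ×_X Spec 𝒪_{X,x}`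

Topic: `Literature/AlgebraicGeometry/Resolution`. A step in the decomposition of the named fact
`Temkin2008_prop234` (`Temkin2008Localization.lean`, Temkin 2008 Prop. 2.3.4: localization of
desingularization). Temkin's Noetherian induction (proof of Prop. 2.3.4, arXiv p. 12) passes
from a blow-up `f : X' → X` to the "pro-open pro-subscheme" `S' = S ×_X X'` of `X'`, where
`S = Spec 𝒪_{X,x}` (§2.1, p. 6: "`S ≅ Spec(𝒪_x)`. Another example is obtained from this one by
base change with respect to a morphism `X' → X`"), using two facts recorded on p. 6–7:

1. "The construction of blow ups commutes with localizations (and, more generally, with flat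
   base changes)" (p. 7) — Görtz–Wedhorn I, Prop. 13.91 (2): for `f : Y → X` flat,
   `Bl_{f⁻¹(Z)}(Y) ≅ Bl_Z(X) ×_X Y`;
2. "the structure morphism `i : S → X` maps `S` homeomorphically onto its image, and `𝒪_S` is
   isomorphic to the restriction of `𝒪_X` on `i(S)`" (p. 6) — the local rings of `S'` are the
   local rings of `X'` at the image points, so `S'_sing = X'_sing ∩ S'`.

Both are PROVED here for Mathlib's schemes, with blow-ups in the sense of the universal
property (`IsBlowup`, `Blowups.lean`, GW Def. 13.90).

## Content (namespace `Literature.AlgGeom`), all PROVED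

* `IsEffectiveCartier.comap_of_flat` — effective Cartier divisors pull back to effective Cartier
  divisors along flat morphisms (GW Prop. 13.91 (1) ingredient; Stacks 02OO (2)).
* `IsBlowup.of_isPullback_of_flat`, `IsBlowup.pullback_snd_of_flat` — **blow-ups commute with
  flat base change** (GW Prop. 13.91 (2)): if `π : X' ⟶ X` is a blow-up along `J` and `ι : S ⟶ X`
  is flat, then `X' ×_X S ⟶ S` is a blow-up along `ι⁻¹J 𝒪_S`. The universal property is formal;
  the exceptional divisor stays Cartier by flatness of `X' ×_X S ⟶ X'`.
* `stalkMap_injective_of_flat`, `isIso_stalkMap_of_flat_of_isPreimmersion`,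
  `mem_regularLocus_iff_of_flat_of_isPreimmersion` — a flat preimmersion (e.g. any base change
  of `Spec 𝒪_{X,x} ⟶ X`) induces isomorphisms on all local rings, hence identifies regular loci.
* `flat_fromSpecStalk` — `Spec 𝒪_{X,x} ⟶ X` is flat (a localization followed by an open
  immersion); with Mathlib's instances, every base change `X' ×_X Spec 𝒪_{X,x} ⟶ X'` is a flat
  preimmersion (`isIso_stalkMap_pullback_fst_fromSpecStalk`,
  `mem_regularLocus_iff_pullback_fst_fromSpecStalk`, `range_pullback_fst_fromSpecStalk`).
* `isIso_stalkMap_of_isIso_morphismRestrict`, `mem_regularLocus_iff_of_isIso_morphismRestrict` —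
  if `π` restricts to an isomorphism over an open `U ∋ π x`, the local rings at `x` and `π x`
  agree (used with `IsBlowup.isIso_morphismRestrict`: a blow-up does not change the local rings
  off its centre).

## Sources

* U. Görtz, T. Wedhorn, *Algebraic Geometry I: Schemes*, 2nd ed., Springer 2020, Prop. 13.91.
  [GortzWedhorn2020]
* M. Temkin, *Desingularization of quasi-excellent schemes in characteristic zero*, Adv. Math.
  219 (2008) 488–522 = arXiv:math/0703678, §2.1 (p. 6–7), proof of Prop. 2.3.4 (p. 12).
  [Temkin2008]
* The Stacks Project, Tag 0805 (blowing up commutes with flat base change), Tag 01J7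
  (`Spec 𝒪_{X,x} → X`). [StacksProject]
-/

noncomputable section

open CategoryTheory CategoryTheory.Limits AlgebraicGeometry TopologicalSpace

namespace Literature.AlgebraicGeometry.Resolution

universe u

/-! ## Flat ring maps preserve regular elements -/

/-- A flat ring homomorphism maps non-zero-divisors to non-zero-divisors. [folklore] -/
theorem map_mem_nonZeroDivisors_of_flat {A B : Type*} [CommRing A] [CommRing B] (φ : A →+* B)
    (hφ : φ.Flat) {g : A} (hg : g ∈ nonZeroDivisors A) : φ g ∈ nonZeroDivisors B := by
  algebraize [φ]
  have hreg : IsSMulRegular B (algebraMap A B g) :=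
    IsSMulRegular.of_flat (Module.Flat.isSMulRegular_of_nonZeroDivisors hg)
  rw [mem_nonZeroDivisors_iff_right]
  intro x hx
  apply hreg
  change algebraMap A B g * x = algebraMap A B g * 0
  rw [mul_zero, mul_comm]
  exact hx

/-! ## Effective Cartier divisors pull back along flat morphisms -/

/-- **Effective Cartier divisors pull back to effective Cartier divisors along flat morphisms**
(Görtz–Wedhorn I, proof of Prop. 13.91 (1); Stacks 02OO): locally the pulled-back ideal is
generated by the image of a regular local equation, which stays regular under a flat ring map.
[cite: GortzWedhorn2020, Prop. 13.91] -/
theorem IsEffectiveCartier.comap_of_flat {X Y : Scheme.{u}} {K : Y.IdealSheafData}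
    (hK : IsEffectiveCartier K) (g : X ⟶ Y) [Flat g] : IsEffectiveCartier (K.comap g) := by
  intro x
  obtain ⟨W, hxW, b, hb, hKW⟩ := hK (g x)
  obtain ⟨W₀, hW₀, hxW₀, hle⟩ :=
    exists_isAffineOpen_mem_and_subset (X := X) (x := x) (U := g ⁻¹ᵁ (W : Y.Opens)) hxW
  have hflat : (g.appLE W W₀ hle).hom.Flat := HasRingHomProperty.appLE @Flat g ‹_› W ⟨W₀, hW₀⟩ hle
  refine ⟨⟨W₀, hW₀⟩, hxW₀, g.appLE W W₀ hle b, map_mem_nonZeroDivisors_of_flat _ hflat hb, ?_⟩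
  rw [ideal_comap_of_le g K W ⟨W₀, hW₀⟩ hle, hKW, Ideal.map_span, Set.image_singleton]

/-! ## Blow-ups commute with flat base change (GW Prop. 13.91 (2)) -/

/-- **Blow-ups commute with flat base change** (Görtz–Wedhorn I, Prop. 13.91 (2): for `f : Y → X`
flat, `Bl_{f⁻¹(Z)}(Y) = Bl_Z(X) ×_X Y`), for an arbitrary cartesian square: if `π : X' ⟶ X` is a
blow-up along `J`, `ι : S ⟶ X` is flat and `fst ≫ π = snd ≫ ι` is cartesian, then `snd : P ⟶ S`
is a blow-up of `S` along `ι⁻¹J 𝒪_S`. The universal property of `snd` is that of `π` composed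
with that of the fibre product; its exceptional divisor `fst⁻¹(π⁻¹ V(J))` is Cartier because
`fst` is flat. [cite: GortzWedhorn2020, Prop. 13.91 (2)] -/
theorem IsBlowup.of_isPullback_of_flat {P X' X S : Scheme.{u}} {fst : P ⟶ X'} {snd : P ⟶ S}
    {π : X' ⟶ X} {ι : S ⟶ X} {J : X.IdealSheafData} (H : IsPullback fst snd π ι)
    (h : IsBlowup π J) [Flat ι] : IsBlowup snd (J.comap ι) := by
  haveI : Flat fst := MorphismProperty.of_isPullback H.flip ‹_›
  constructor
  · rw [← Scheme.IdealSheafData.comap_comp, ← H.w, Scheme.IdealSheafData.comap_comp]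
    exact h.isEffectiveCartier.comap_of_flat fst
  · intro W a ha
    rw [← Scheme.IdealSheafData.comap_comp] at ha
    obtain ⟨b, hb, hbu⟩ := h.universal (a ≫ ι) ha
    refine ⟨H.lift b a hb, H.lift_snd b a hb, fun c hc => ?_⟩
    have hc : c ≫ snd = a := hc
    apply H.hom_ext
    · rw [H.lift_fst]
      exact hbu _ (show (c ≫ fst) ≫ π = a ≫ ι by rw [Category.assoc, H.w, reassoc_of% hc])
    · rw [H.lift_snd, hc]

/-- **Blow-ups commute with flat base change**, for the chosen fibre product: if `π : X' ⟶ X` is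
a blow-up along `J` and `ι : S ⟶ X` is flat, then `pullback.snd π ι : X' ×_X S ⟶ S` is a blow-up
along `ι⁻¹J 𝒪_S`. [cite: GortzWedhorn2020, Prop. 13.91 (2)] -/
theorem IsBlowup.pullback_snd_of_flat {X' X S : Scheme.{u}} {π : X' ⟶ X} {J : X.IdealSheafData}
    (h : IsBlowup π J) (ι : S ⟶ X) [Flat ι] : IsBlowup (pullback.snd π ι) (J.comap ι) :=
  h.of_isPullback_of_flat (IsPullback.of_hasPullback π ι)

/-! ## Flat preimmersions induce isomorphisms of local rings -/

/-- The stalk maps of a flat morphism are injective (a flat local homomorphism of local rings is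
faithfully flat). [folklore] -/
theorem stalkMap_injective_of_flat {X Y : Scheme.{u}} (f : X ⟶ Y) [Flat f] (x : X) :
    Function.Injective (f.stalkMap x) := by
  algebraize [(f.stalkMap x).hom]
  have : Module.FaithfullyFlat (Y.presheaf.stalk (f x)) (X.presheaf.stalk x) :=
    @Module.FaithfullyFlat.of_flat_of_isLocalHom _ _ _ _ _ _ _
      (Flat.stalkMap f x) (f.toLRSHom.prop x)
  exact FaithfulSMul.algebraMap_injective (Y.presheaf.stalk (f x)) (X.presheaf.stalk x)

/-- **A flat preimmersion induces isomorphisms on all local rings**: the stalk maps of a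
preimmersion are surjective, those of a flat morphism injective. (Temkin 2008, §2.1, p. 6, for
the pro-open pro-subschemes `Spec 𝒪_{X,x} ×_X X' → X'`: "`𝒪_S` is isomorphic to the
restriction of `𝒪_X` on `i(S)`".) [cite: Temkin2008, §2.1 (p. 6)] -/
theorem isIso_stalkMap_of_flat_of_isPreimmersion {X Y : Scheme.{u}} (f : X ⟶ Y) [Flat f]
    [IsPreimmersion f] (x : X) : IsIso (f.stalkMap x) :=
  (ConcreteCategory.isIso_iff_bijective _).mpr
    ⟨stalkMap_injective_of_flat f x, f.stalkMap_surjective x⟩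

/-- Along a flat preimmersion, a point is regular iff its image is. [folklore] -/
theorem mem_regularLocus_iff_of_flat_of_isPreimmersion {X Y : Scheme.{u}} (f : X ⟶ Y) [Flat f]
    [IsPreimmersion f] (x : X) :
    x ∈ Scheme.regularLocus X ↔ f x ∈ Scheme.regularLocus Y := by
  haveI := isIso_stalkMap_of_flat_of_isPreimmersion f x
  let e : Y.presheaf.stalk (f x) ≃+* X.presheaf.stalk x := (asIso (f.stalkMap x)).commRingCatIsoToRingEquiv
  simp only [Scheme.mem_regularLocus]
  exact ⟨fun h => IsRegularLocalRing.of_ringEquiv e.symm, fun h => IsRegularLocalRing.of_ringEquiv e⟩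

/-! ## `Spec 𝒪_{X,x} ⟶ X` is flat -/

/-- `Spec 𝒪_{X,x} ⟶ X` is flat: through an affine open neighbourhood `U` of `x` it is
`Spec` of the localization `Γ(X, U) → 𝒪_{X,x}` followed by the open immersion `U ↪ X`
(Stacks 01J7). [cite: StacksProject, Tag 01J7] -/
theorem flat_fromSpecStalk (X : Scheme.{u}) (x : X) : Flat (X.fromSpecStalk x) := by
  obtain ⟨U, hU, hxU, -⟩ :=
    exists_isAffineOpen_mem_and_subset (X := X) (x := x) (U := ⊤) trivial
  rw [← hU.fromSpecStalk_eq_fromSpecStalk hxU, IsAffineOpen.fromSpecStalk]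
  haveI : Flat (Spec.map (X.presheaf.germ U x hxU)) := by
    rw [Flat.SpecMap_iff]
    letI : Algebra Γ(X, U) (X.presheaf.stalk x) := (X.presheaf.germ U x hxU).hom.toAlgebra
    have hloc : IsLocalization.AtPrime (X.presheaf.stalk x) (hU.primeIdealOf ⟨x, hxU⟩).asIdeal :=
      hU.isLocalization_stalk ⟨x, hxU⟩
    have : Module.Flat Γ(X, U) (X.presheaf.stalk x) :=
      IsLocalization.flat (X.presheaf.stalk x) (hU.primeIdealOf ⟨x, hxU⟩).asIdeal.primeCompl
    exact RingHom.flat_algebraMap_iff.mpr this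
  infer_instance

/-! ## The pro-open pro-subscheme `X' ×_X Spec 𝒪_{X,x}` of `X'` -/

section ProOpen

variable {X' X : Scheme.{u}} (π : X' ⟶ X) (x : X)

/-- The projection `X' ×_X Spec 𝒪_{X,x} ⟶ X'` induces isomorphisms on all local rings (Temkin
2008, §2.1: a pro-open pro-subscheme). [cite: Temkin2008, §2.1 (p. 6)] -/
theorem isIso_stalkMap_pullback_fst_fromSpecStalk (s : ↑(pullback π (X.fromSpecStalk x))) :
    IsIso ((pullback.fst π (X.fromSpecStalk x)).stalkMap s) := by
  haveI := flat_fromSpecStalk X x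
  exact isIso_stalkMap_of_flat_of_isPreimmersion _ s

/-- **`S'_sing = X'_sing ∩ S'`** for the pro-open pro-subscheme `S' = X' ×_X Spec 𝒪_{X,x}` of
`X'` (Temkin 2008, proof of Prop. 2.3.4: "`T' = (S', Z'_S)_sing` equals to `(X', Z')_sing ∩ S'`
because `S'` is a pro-open pro-subscheme of `X'`"): a point of `S'` is regular iff its image in
`X'` is. [cite: Temkin2008, Prop. 2.3.4 (proof, p. 12)] -/
theorem mem_regularLocus_iff_pullback_fst_fromSpecStalk
    (s : ↑(pullback π (X.fromSpecStalk x))) :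
    s ∈ Scheme.regularLocus (pullback π (X.fromSpecStalk x)) ↔
      pullback.fst π (X.fromSpecStalk x) s ∈ Scheme.regularLocus X' := by
  haveI := flat_fromSpecStalk X x
  exact mem_regularLocus_iff_of_flat_of_isPreimmersion _ s

/-- The image of `X' ×_X Spec 𝒪_{X,x} ⟶ X'` is the set of points of `X'` lying over
generizations of `x`. [cite: StacksProject, Tag 01J7] -/
theorem range_pullback_fst_fromSpecStalk :
    Set.range (pullback.fst π (X.fromSpecStalk x)) = {x' | π x' ⤳ x} := by
  rw [Scheme.Pullback.range_fst, Scheme.range_fromSpecStalk]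
  rfl

/-- Every point of `X'` over `x` itself lies in the image of `X' ×_X Spec 𝒪_{X,x} ⟶ X'`.
[folklore] -/
theorem mem_range_pullback_fst_fromSpecStalk_of_eq {x' : X'} (hx' : π x' = x) :
    x' ∈ Set.range (pullback.fst π (X.fromSpecStalk x)) := by
  rw [range_pullback_fst_fromSpecStalk]
  exact hx' ▸ specializes_rfl

end ProOpen

/-! ## Local rings do not change where a morphism restricts to an isomorphism -/

/-- If `π` restricts to an isomorphism over an open `U ⊆ X` and `π x ∈ U`, then the stalk map
`𝒪_{X, π x} ⟶ 𝒪_{X', x}` is an isomorphism. [folklore] -/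
theorem isIso_stalkMap_of_isIso_morphismRestrict {X' X : Scheme.{u}} (π : X' ⟶ X) (U : X.Opens)
    [IsIso (π ∣_ U)] (x : X') (hx : π x ∈ U) : IsIso (π.stalkMap x) := by
  let x₀ : ↑(π ⁻¹ᵁ U) := ⟨x, hx⟩
  have h1 : IsIso ((π ∣_ U).stalkMap x₀) := inferInstance
  have e := morphismRestrictStalkMap π U x₀
  exact (Arrow.isIso_iff_isIso_of_isIso e.hom).mp h1 |> fun h => by simpa using h

/-- If `π` restricts to an isomorphism over an open `U ⊆ X` and `π x ∈ U`, then `x` is a regular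
point iff `π x` is. [folklore] -/
theorem mem_regularLocus_iff_of_isIso_morphismRestrict {X' X : Scheme.{u}} (π : X' ⟶ X)
    (U : X.Opens) [IsIso (π ∣_ U)] (x : X') (hx : π x ∈ U) :
    x ∈ Scheme.regularLocus X' ↔ π x ∈ Scheme.regularLocus X := by
  haveI := isIso_stalkMap_of_isIso_morphismRestrict π U x hx
  let e : X.presheaf.stalk (π x) ≃+* X'.presheaf.stalk x :=
    (asIso (π.stalkMap x)).commRingCatIsoToRingEquiv
  simp only [Scheme.mem_regularLocus]
  exact ⟨fun h => IsRegularLocalRing.of_ringEquiv e.symm, fun h => IsRegularLocalRing.of_ringEquiv e⟩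

end Literature.AlgebraicGeometry.Resolution

end
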